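import Mathlib
import Literature.Computability.Complexity.RangeAvoidance
import Literature.Computability.Complexity.SignDegreeXor
import Summits.PneNP.PneNP.Theorems.PstarIsolation

/-!
# Isolation of the all-ones range point of a pure `P⋆` local map — the isolation theorem (K2)

FRONTIER range-avoidance ladder, rung F-N3(ψ) (cell `pnp-ideate`, ROUND-19, mechanism M19; restricted-model
algorithmics — nothing here bears on `P` vs `NP`).

From the flip inequality `PstarIsolation.flipInequality`
`6·volA(U) + 10·eL(U) ≤ 6·|Ψ(U)| + 6·eA(U) + 5·volL(U) + eLA(U)`
and the poly-time-checkable promise `PseudoRandom η κ` (near-regular XOR/AND volumes, expander-mixing discrepancy of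
the XOR graph, the AND graph and the XOR–AND co-occurrence graph) one gets, for every vertex set `U` with `u = |U|` and
`C = m/n`, `6|Ψ(U)| ≥ u·(2C − 22ηC − 18κ√C)` — the `u²/n` main terms of the three edge counts cancel (`10 = 6 + 4`).
For `η = 1/50`, `κ = 2`, `C ≥ 900` the right-hand side exceeds `6` when `u ≥ 1`, so NO non-empty `U` flips exactly one
output: every Hamming neighbour `1ᵐ ⊕ e_i` of `1ᵐ = C(1ⁿ)` is outside the range (`isolationTheorem`, `C₀ = 900`).
-/

set_option linter.dupNamespace false

open Finset Literature.Computability.Complexity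
open Summit.PneNP.PneNP.Theorems.PstarIsolation

namespace Summit.PneNP.PneNP.Theorems.PstarIsolationBound

variable {n m : ℕ}

/-- Every Hamming neighbour of `1ᵐ` lies outside the range of `I`. -/
def AllOnesIsolated (I : LocalMap 4 n m) : Prop := ∀ i : Fin m, onesFlip i ∉ I.range

/-- **The promise `PseudoRandom η κ I`** (poly-time checkable).  With `C = m/n`:
(i) near-regularity in VOLUME form — for every vertex set `U`, `volL(U) ≤ (1+η)·2C·|U|` and `(1−η)·2C·|U| ≤ volA(U)`
(equivalent, by additivity of volumes, to the per-vertex degree bounds `degL ≤ (1+η)2C`, `degA ≥ (1−η)2C`);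
(ii) discrepancy (expander mixing with second eigenvalue `≈ 2κ√C`) — `eL(U) ≥ C|U|²/n − κ√C|U|`,
`eA(U) ≤ C|U|²/n + κ√C|U|`, `eLA(U) ≤ 4C|U|²/n + 2κ√C|U|`.  Only the one-sided bounds the argument uses are imposed.
Random slot-regular instances satisfy it with `κ ≈ √2` (Friedman-type second-eigenvalue theorems; not formalised). -/
def PseudoRandom (η κ : ℝ) (I : LocalMap 4 n m) : Prop :=
  ∀ U : Finset (Fin n),
    (volL I U : ℝ) ≤ (1 + η) * (2 * ((m : ℝ) / n)) * U.card ∧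
    (1 - η) * (2 * ((m : ℝ) / n)) * U.card ≤ (volA I U : ℝ) ∧
    (m : ℝ) / n ^ 2 * (U.card : ℝ) ^ 2 - κ * Real.sqrt ((m : ℝ) / n) * U.card ≤ (eL I U : ℝ) ∧
    (eA I U : ℝ) ≤ (m : ℝ) / n ^ 2 * (U.card : ℝ) ^ 2 + κ * Real.sqrt ((m : ℝ) / n) * U.card ∧
    (eLA I U : ℝ) ≤ 4 * ((m : ℝ) / n ^ 2 * (U.card : ℝ) ^ 2) + 2 * κ * Real.sqrt ((m : ℝ) / n) * U.card

/-- **K2 — the isolation theorem** (statement): pure `P⋆` + `PseudoRandom (1/50) 2` + `m ≥ C₀ n` ⇒ every Hamming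
neighbour of `1ᵐ` is outside the range. -/
def IsolationTheorem : Prop :=
  ∃ C₀ : ℕ, ∀ (n m : ℕ) (I : LocalMap 4 n m), I.IsPure xorAndPred → PseudoRandom (1 / 50) 2 I →
    0 < n → C₀ * n ≤ m → AllOnesIsolated I

/-- The flip bound: under the promise, a vertex set `U` with `u = |U|` satisfies
`(78/50·C − 36·√C)·u ≤ 6·|Ψ(U)|` (`C = m/n`). -/
theorem flip_bound (I : LocalMap 4 n m) (hI : I.IsPure xorAndPred) (hR : PseudoRandom (1 / 50) 2 I)
    (U : Finset (Fin n)) :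
    (78 / 50 * ((m : ℝ) / n) - 36 * Real.sqrt ((m : ℝ) / n)) * U.card ≤ 6 * ((flipped I U).card : ℝ) := by
  have hK : (6 * volA I U + 10 * eL I U : ℕ) ≤ 6 * (flipped I U).card + 6 * eA I U + 5 * volL I U + eLA I U :=
    flipInequality n m I hI U
  have hK' : 6 * (volA I U : ℝ) + 10 * (eL I U : ℝ) ≤
      6 * ((flipped I U).card : ℝ) + 6 * (eA I U : ℝ) + 5 * (volL I U : ℝ) + (eLA I U : ℝ) := by
    exact_mod_cast hK
  obtain ⟨hvL, hvA, heL, heA, heLA⟩ := hR U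
  nlinarith [hvL, hvA, heL, heA, heLA, hK']

/-- **K2.** The isolation theorem with `C₀ = 900`. -/
theorem allOnesIsolated_of_pseudoRandom (I : LocalMap 4 n m) (hI : I.IsPure xorAndPred)
    (hR : PseudoRandom (1 / 50) 2 I) (hn : 0 < n) (hm : 900 * n ≤ m) : AllOnesIsolated I := by
  intro i hi
  obtain ⟨x, hx⟩ := hi
  set U : Finset (Fin n) := univ.filter fun v => x v = false with hU
  have hcard : (flipped I U).card = 1 := flipped_card_of_preimage I x i hx
  have hne : U.Nonempty := support_nonempty_of_preimage I hI x i hx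
  have hu : (1 : ℝ) ≤ U.card := by exact_mod_cast hne.card_pos
  have hn' : (0 : ℝ) < n := by exact_mod_cast hn
  have hC : (900 : ℝ) ≤ (m : ℝ) / n := by
    rw [le_div_iff₀ hn']; exact_mod_cast hm
  set s : ℝ := Real.sqrt ((m : ℝ) / n) with hs
  have hs_sq : s ^ 2 = (m : ℝ) / n := Real.sq_sqrt (by positivity)
  have hs30 : 30 ≤ s := by
    have h9 : Real.sqrt 900 = 30 := by
      rw [show (900 : ℝ) = 30 ^ 2 by norm_num]; exact Real.sqrt_sq (by norm_num)
    rw [← h9]; exact Real.sqrt_le_sqrt hC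
  have hb := flip_bound I hI hR U
  rw [hcard] at hb
  have hpos : (324 : ℝ) ≤ 78 / 50 * ((m : ℝ) / n) - 36 * s := by
    rw [← hs_sq]; nlinarith [hs30]
  have hmono : (78 / 50 * ((m : ℝ) / n) - 36 * s) * 1 ≤ (78 / 50 * ((m : ℝ) / n) - 36 * s) * U.card :=
    mul_le_mul_of_nonneg_left hu (by linarith)
  push_cast at hb
  linarith

/-- **K2** as the typed statement. -/
theorem isolationTheorem : IsolationTheorem :=
  ⟨900, fun _ _ I hI hR hn hm => allOnesIsolated_of_pseudoRandom I hI hR hn hm⟩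

end Summit.PneNP.PneNP.Theorems.PstarIsolationBound
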